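import Literature.NumberTheory.EllipticCurves.ManinConstantModularDegree
import Literature.NumberTheory.EllipticCurves.ModularDegreeQuadraticTwistProofs
import Literature.NumberTheory.EllipticCurves.QuadraticTwistNegOneLFunctionProofs
import Literature.NumberTheory.EllipticCurves.QuadraticTwistTwoLFunctionProofs
import Literature.NumberTheory.DiophantineGeometry.EllArithGlue
import Mathlib.FieldTheory.IsAlgClosed.Basic
import HarnessLib

/-!
# The modular degree under a same-level quadratic twist: Watkins' identity for a general twisting
# discriminant, and its `p`-adic valuation form (proofs only; no new facts)

[importance: standard (the twist-degree bookkeeping of Watkins 2002 §2.1 / Delaunay 2003 for ANY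
quadratic twist at a common level, and the resulting dictionary between `p`-adic invariance of the Manin
constant and of `6·v_p(deg φ) − v_p(Δ_min)` on a twist orbit — requested by cell `bsd-f2-manin`
(planner-of-record `bsd-f2-manin-imc`, ask T-imc-4 (ii), scratch HOME/imc/Sketch-imc-g1b.lean
5b2d0d78650c95fc) as the print half of its ramified-twist laws E-imc-2 / E-imc-6ₚ / E-imc-8)]

Everything here is PROVED from theorems already in the tree; the file introduces no `def … : Prop`.

* `ModularParametrizationData.deg_mul_sq_mul_sq_eq_of_quadraticTwist_of_natAbs_eq` — for
  `W′ = C • (W ⊗ χ_d)` (`d ≠ 0`) with `|aₙ(W′)| = |aₙ(W)|` for all `n`, and parametrisation data `D`, `D′`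
  of `W`, `W′` at a common level `N`: `D′.deg · D.c² · u(C)² = |d| · D.deg · D′.c²`. This is the tree's
  `deg_mul_sq_mul_sq_eq_of_quadraticTwist_pStar` (Watkins 2002 §2.1, p. 491: Zagier's formula for both
  data, Delaunay's equal-level Rankin–Selberg comparison, Pal's covolume `covol Λ(W ⊗ d) = covol Λ(W)/|d|`)
  with `p*` replaced by a general `d`.
* `ModularParametrizationData.padicValInt_c_eq_iff_of_quadraticTwist_of_natAbs_eq` — under the same
  hypotheses with both models globally minimal, at EVERY prime `p`:
  `v_p(c′) = v_p(c) ↔ 6·v_p(deg′) + v_p(Δ_min W) = 6·v_p(deg) + v_p(Δ_min W′)` (the `v_p(d)` contributions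
  of `|d|` and of `Δ(C • (W ⊗ d)) = u⁻¹² d⁶ Δ(W)` cancel).
* `WeierstrassCurve.natAbs_LFunction_eq_of_quadraticTwist_neg_one` / `_two` / `_neg_two` — the `p = 2`
  instances of the coefficient hypothesis: `W` with `aₙ(W) = 0` for even `n`, the naive twist by
  `d ∈ {−1, 2, −2}` additive at the place over `2`; from the tree's `LFunction_quadraticTwist_neg_one_apply`
  / `_two_apply` / `_neg_two_apply` (`χ₄`, `χ₈`, `χ₈′`).
* `ModularParametrizationData.padicValInt_two_c_eq_iff_of_quadraticTwist_neg_one` / `_two` / `_neg_two`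
  — the resulting `2`-adic dictionaries.

## References
* [Watkins2002] M. Watkins, Computing the modular degree of an elliptic curve, Experiment. Math. 11
  (2002), §2.1 (p. 491).
* [Delaunay2003] C. Delaunay, Computing modular degrees using L-functions, JTNB 15 (2003), Thm 1.
* [Pal2012] V. Pal, Periods of quadratic twists of elliptic curves, Proc. AMS 140 (2012), Prop. 2.5,
  Lemma 3.1, Remark 2.3.
* [SilvermanAEC2009] J. H. Silverman, The Arithmetic of Elliptic Curves, 2nd ed., III §1 Table 3.1
  (`u¹²Δ′ = Δ`).
-/

noncomputable section

open scoped MatrixGroups ModularForm Real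
open CongruenceSubgroup WeierstrassCurve IsDedekindDomain IsDedekindDomain.HeightOneSpectrum NumberField
  Rat.HeightOneSpectrum
  Literature.NumberTheory.DiophantineGeometry
  Literature.NumberTheory.EllipticCurves
  Literature.NumberTheory.EllipticCurves.ModularForms

namespace Literature.NumberTheory.EllipticCurves.ModularForms

namespace ModularParametrizationData

/-- **Watkins' identity for a general same-level quadratic twist (model form).** If `W′ = C • (W ⊗ χ_d)`
(`d ≠ 0`) and `|aₙ(W′)| = |aₙ(W)|` for every `n`, then for parametrisation data `D`, `D′` of `W`, `W′` at a
common level `N`: `D′.deg · D.c² · u(C)² = |d| · D.deg · D′.c²` (Zagier's formula for both data, equal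
Petersson norms from equal `|aₙ|`, and `covol Λ(W ⊗ d) = covol Λ(W)/|d|`; the tree's
`deg_mul_sq_mul_sq_eq_of_quadraticTwist_pStar` with `p*` replaced by a general `d`).
[cite: Watkins2002, §2.1 (p. 491)] [cite: Delaunay2003, Thm 1 (p. 675)] [cite: Pal2012, Lemma 3.1 and Remark 2.3] -/
theorem deg_mul_sq_mul_sq_eq_of_quadraticTwist_of_natAbs_eq
    {W W' : WeierstrassCurve ℚ} [W.IsElliptic] {N : ℕ} [NeZero N]
    (d : ℚ) (hd : d ≠ 0) (C : WeierstrassCurve.VariableChange ℚ)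
    (hW' : C • W.quadraticTwist d = W')
    (habs : ∀ n : ℕ, (W'.LFunction n).natAbs = (W.LFunction n).natAbs)
    (D : ModularParametrizationData W N) (D' : ModularParametrizationData W' N) :
    (D'.deg : ℝ) * (D.c : ℝ) ^ 2 * ((C.u : ℚ) : ℝ) ^ 2 = |(d : ℝ)| * D.deg * (D'.c : ℝ) ^ 2 := by
  have hdabs : ‖((d : ℚ) : ℂ)‖ = |(d : ℝ)| := by
    rw [show ((d : ℚ) : ℂ) = (((d : ℝ)) : ℂ) by norm_cast, Complex.norm_real, Real.norm_eq_abs]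
  have hd0 : ((d : ℚ) : ℂ) ≠ 0 := by exact_mod_cast hd
  have hdR0 : |(d : ℝ)| ≠ 0 := by
    rw [abs_ne_zero]
    exact_mod_cast hd
  set T := W.quadraticTwist d with hT
  haveI : T.IsElliptic := W.isElliptic_quadraticTwist hd
  -- (1) coefficient sizes agree
  have hcoef : ∀ n : ℕ, ‖cuspCoeff D'.f n‖ = ‖cuspCoeff D.f n‖ := by
    intro n
    rw [D'.isNewformOf.2 n, D.isNewformOf.2 n, Complex.norm_intCast, Complex.norm_intCast]
    have key := congrArg (fun m : ℕ ↦ (m : ℝ)) (habs n)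
    simp only [Nat.cast_natAbs, Int.cast_abs] at key
    exact key
  -- (2) equal Petersson norms
  have hP : (peterssonProduct (Gamma0 N) 2 D'.f D'.f).re = (peterssonProduct (Gamma0 N) 2 D.f D.f).re :=
    peterssonProduct_re_eq_of_norm_cuspCoeff_eq D.f D'.f hcoef
  -- (3) covolumes
  have h4 : (T.baseChange ℂ).c₄ = ((d : ℚ) : ℂ) ^ 2 * (W.baseChange ℂ).c₄ := by
    simp only [hT, WeierstrassCurve.baseChange, WeierstrassCurve.map_c₄,
      WeierstrassCurve.quadraticTwist_c₄, map_mul, map_pow, eq_ratCast]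
  have h6 : (T.baseChange ℂ).c₆ = ((d : ℚ) : ℂ) ^ 3 * (W.baseChange ℂ).c₆ := by
    simp only [hT, WeierstrassCurve.baseChange, WeierstrassCurve.map_c₆,
      WeierstrassCurve.quadraticTwist_c₆, map_mul, map_pow, eq_ratCast]
  obtain ⟨LT, hLT⟩ : ∃ LT : PeriodPair, IsNeronLatticeOf (T.baseChange ℂ) LT := by
    obtain ⟨s, hs⟩ := IsAlgClosed.exists_pow_nat_eq ((d : ℚ) : ℂ) zero_lt_two
    have hs0 : s ≠ 0 := by
      rintro rfl
      exact hd0 (by rw [← hs]; simp)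
    refine ⟨D.L.mulLeft s⁻¹ (inv_ne_zero hs0), ?_, ?_⟩
    · rw [PeriodPair.g₂_mulLeft, D.isNeronLattice.1, h4, ← hs, inv_pow, inv_inv]
      ring
    · rw [PeriodPair.g₃_mulLeft, D.isNeronLattice.2, h6, ← hs, inv_pow, inv_inv]
      ring
  have hcovT : ZLattice.covolume LT.lattice = ZLattice.covolume D.L.lattice / |(d : ℝ)| := by
    rw [IsNeronLatticeOf.covolume_eq_div_of_c₄_eq_of_c₆_eq hd0 h4 h6 D.isNeronLattice hLT, hdabs]
  have hD'L : IsNeronLatticeOf ((C • T).baseChange ℂ) D'.L := by rw [hW']; exact D'.isNeronLattice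
  have hcov' : ZLattice.covolume D'.L.lattice =
      ((C.u : ℚ) : ℝ) ^ 2 * (ZLattice.covolume D.L.lattice / |(d : ℝ)|) := by
    rw [IsNeronLatticeOf.lattice_eq_mulLeft_of_smul C hLT hD'L, PeriodPair.covolume_mulLeft_lattice,
      hcovT]
    congr 1
    rw [show (((C.u : ℚ) : ℂ)) = ((((C.u : ℚ) : ℝ)) : ℂ) by norm_cast, Complex.norm_real,
      Real.norm_eq_abs, sq_abs]
  -- (4) Zagier for both data, and the algebra
  have hZ := D.deg_mul_covolume_eq_re
  have hZ' := D'.deg_mul_covolume_eq_re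
  rw [hcov', hP] at hZ'
  have hcov0 : ZLattice.covolume D.L.lattice ≠ 0 := (ZLattice.covolume_pos _ _).ne'
  have key : (D'.deg : ℝ) * (((C.u : ℚ) : ℝ) ^ 2 * (ZLattice.covolume D.L.lattice / |(d : ℝ)|)) * (D.c : ℝ) ^ 2 =
      (D'.c : ℝ) ^ 2 * ((D.deg : ℝ) * ZLattice.covolume D.L.lattice) := by
    rw [hZ', hZ]
    ring
  have e : ZLattice.covolume D.L.lattice / |(d : ℝ)| * |(d : ℝ)| = ZLattice.covolume D.L.lattice :=
    div_mul_cancel₀ _ hdR0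
  have key' : ((D'.deg : ℝ) * (D.c : ℝ) ^ 2 * ((C.u : ℚ) : ℝ) ^ 2) * ZLattice.covolume D.L.lattice =
      (|(d : ℝ)| * D.deg * (D'.c : ℝ) ^ 2) * ZLattice.covolume D.L.lattice := by
    calc ((D'.deg : ℝ) * (D.c : ℝ) ^ 2 * ((C.u : ℚ) : ℝ) ^ 2) * ZLattice.covolume D.L.lattice
        = ((D'.deg : ℝ) * (D.c : ℝ) ^ 2 * ((C.u : ℚ) : ℝ) ^ 2) *
            (ZLattice.covolume D.L.lattice / |(d : ℝ)| * |(d : ℝ)|) := by rw [e]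
      _ = ((D'.deg : ℝ) * (((C.u : ℚ) : ℝ) ^ 2 * (ZLattice.covolume D.L.lattice / |(d : ℝ)|)) * (D.c : ℝ) ^ 2) *
            |(d : ℝ)| := by ring
      _ = ((D'.c : ℝ) ^ 2 * ((D.deg : ℝ) * ZLattice.covolume D.L.lattice)) * |(d : ℝ)| := by rw [key]
      _ = (|(d : ℝ)| * D.deg * (D'.c : ℝ) ^ 2) * ZLattice.covolume D.L.lattice := by ring
  exact mul_right_cancel₀ hcov0 key'

/-- **`p`-adic form of Watkins' identity: invariance of `v_p` of the Manin constant ⟺ invariance of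
`6·v_p(deg φ) − v_p(Δ_min)`.** For a same-level quadratic twist pair `W′ = C • (W ⊗ χ_d)` (`d ≠ 0`) with
`|aₙ(W′)| = |aₙ(W)|`, both models globally minimal, data `D`, `D′` at a common level, and ANY prime `p`:
`v_p(D′.c) = v_p(D.c) ↔ 6·v_p(D′.deg) + v_p(Δ_min W) = 6·v_p(D.deg) + v_p(Δ_min W′)` — the valuations of
the identity `D′.deg · D.c² · u² = |d| · D.deg · D′.c²` and of `Δ_min(W′) = u⁻¹² d⁶ Δ_min(W)`; the
`v_p(d)` contributions cancel. (The dictionary used by cell `bsd-f2-manin`, MEMO-imc §9, between its laws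
E-imc-2 and E-imc-6ₚ.)
[cite: Watkins2002, §2.1 (p. 491)] [cite: SilvermanAEC2009, III §1 Table 3.1 (u¹²Δ′ = Δ)] -/
theorem padicValInt_c_eq_iff_of_quadraticTwist_of_natAbs_eq (p : ℕ) [Fact p.Prime]
    {W W' : WeierstrassCurve ℚ} [W.IsElliptic] [W.IsGloballyMinimal] [W'.IsElliptic]
    [W'.IsGloballyMinimal] {N : ℕ} [NeZero N]
    (d : ℚ) (hd : d ≠ 0) (C : WeierstrassCurve.VariableChange ℚ)
    (hW' : C • W.quadraticTwist d = W')
    (habs : ∀ n : ℕ, (W'.LFunction n).natAbs = (W.LFunction n).natAbs)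
    (D : ModularParametrizationData W N) (D' : ModularParametrizationData W' N) :
    padicValInt p D'.maninConstant = padicValInt p D.maninConstant ↔
      6 * padicValNat p D'.modularDegree + padicValInt p W.minimalDiscriminantInt =
        6 * padicValNat p D.modularDegree + padicValInt p W'.minimalDiscriminantInt := by
  have hp : p.Prime := Fact.out
  simp only [ModularParametrizationData.maninConstant, ModularParametrizationData.modularDegree]
  -- (1) Watkins' identity, in ℚ
  have hWat := deg_mul_sq_mul_sq_eq_of_quadraticTwist_of_natAbs_eq d hd C hW' habs D D'
  have hWatQ : (D'.deg : ℚ) * (D.c : ℚ) ^ 2 * (C.u : ℚ) ^ 2 = |d| * D.deg * (D'.c : ℚ) ^ 2 := by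
    have : (|(d : ℝ)|) = ((|d| : ℚ) : ℝ) := by push_cast; rfl
    rw [this] at hWat
    exact_mod_cast hWat
  -- (2) the minimal discriminants
  have hΔ : (W'.minimalDiscriminantInt : ℚ) = ((C.u : ℚ)⁻¹) ^ 12 * d ^ 6 * (W.minimalDiscriminantInt : ℚ) := by
    rw [cast_minimalDiscriminantInt, cast_minimalDiscriminantInt, ← hW', variableChange_Δ,
      quadraticTwist_Δ]
    (try simp only [Units.val_inv_eq_inv_val])
    ring
  -- nonvanishing
  have hdeg0 : (D.deg : ℚ) ≠ 0 := by exact_mod_cast D.deg_pos.ne'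
  have hdeg0' : (D'.deg : ℚ) ≠ 0 := by exact_mod_cast D'.deg_pos.ne'
  have hc0 : (D.c : ℚ) ≠ 0 := by exact_mod_cast D.maninConstant_ne_zero_holds
  have hc0' : (D'.c : ℚ) ≠ 0 := by exact_mod_cast D'.maninConstant_ne_zero_holds
  have hu0 : (C.u : ℚ) ≠ 0 := C.u.ne_zero
  have hΔ0 : (W.minimalDiscriminantInt : ℚ) ≠ 0 := by exact_mod_cast minimalDiscriminantInt_ne_zero W
  have hda0 : (|d| : ℚ) ≠ 0 := abs_ne_zero.mpr hd
  -- v_p(|d|) = v_p(d)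
  have hvabs : padicValRat p |d| = padicValRat p d := by
    rcases le_total 0 d with h | h
    · rw [abs_of_nonneg h]
    · rw [abs_of_nonpos h, padicValRat.neg]
  -- (1') valuations of Watkins' identity
  have e1 := congrArg (padicValRat p) hWatQ
  rw [padicValRat.mul (mul_ne_zero hdeg0' (pow_ne_zero _ hc0)) (pow_ne_zero _ hu0),
    padicValRat.mul hdeg0' (pow_ne_zero _ hc0),
    padicValRat.mul (mul_ne_zero hda0 hdeg0) (pow_ne_zero _ hc0'),
    padicValRat.mul hda0 hdeg0,
    padicValRat.pow, padicValRat.pow, padicValRat.pow, hvabs,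
    padicValRat.of_nat, padicValRat.of_nat, padicValRat.of_int, padicValRat.of_int] at e1
  -- (2') valuations of the discriminant identity
  have e2 := congrArg (padicValRat p) hΔ
  rw [padicValRat.mul (mul_ne_zero (pow_ne_zero _ (inv_ne_zero hu0)) (pow_ne_zero _ hd)) hΔ0,
    padicValRat.mul (pow_ne_zero _ (inv_ne_zero hu0)) (pow_ne_zero _ hd),
    padicValRat.pow, padicValRat.pow, padicValRat.inv,
    padicValRat.of_int, padicValRat.of_int] at e2
  (try simp only [Nat.cast_ofNat] at e1)
  (try simp only [Nat.cast_ofNat] at e2)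
  constructor
  · intro h
    omega
  · intro h
    omega

/-! ### The `p = 2` instances: twists by `−1`, `2`, `−2` of a curve with `a₂ₘ = 0` -/

/-- `|χ(n) · a(n)| = |a(n)|` bookkeeping: if `a n = 0` whenever `n` is even and `|χ n| = 1` whenever `n`
is odd (elementary; helper for the `p = 2` instances below). [folklore] -/
private theorem natAbs_mul_eq_of_even_odd {χ : ℕ → ℤ} {a : ℕ → ℤ} (h0 : ∀ n : ℕ, 2 ∣ n → a n = 0)
    (h1 : ∀ n : ℕ, ¬ 2 ∣ n → (χ n).natAbs = 1) (n : ℕ) : (χ n * a n).natAbs = (a n).natAbs := by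
  by_cases hn : 2 ∣ n
  · simp [h0 n hn]
  · rw [Int.natAbs_mul, h1 n hn, one_mul]

/-- **Twist by `−1` (`χ₄`) at `2`.** If `aₙ(W) = 0` for all even `n` (e.g. `W` additive at `2`), the naive
twist `W ⊗ (−1)` is additive at the place over `2`, and `W′ = C • (W ⊗ (−1))`, then `|aₙ(W′)| = |aₙ(W)|`
for all `n` (from the tree's `LFunction_quadraticTwist_neg_one_apply`: `aₙ(W ⊗ (−1)) = χ₄(n)·aₙ(W)`).
[cite: SilvermanAEC2009, X.5 Cor. 5.4 and Exercise 10.16 (coefficients of a quadratic twist)] -/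
theorem _root_.WeierstrassCurve.natAbs_LFunction_eq_of_quadraticTwist_neg_one
    {W W' : WeierstrassCurve ℚ} [W.IsElliptic] (C : WeierstrassCurve.VariableChange ℚ)
    (hW' : C • W.quadraticTwist (-1) = W')
    (hW0 : ∀ n : ℕ, 2 ∣ n → W.LFunction n = 0)
    (hadd : ∀ v : HeightOneSpectrum (𝓞 ℚ), (primesEquiv v : ℕ) = 2 →
      (W.quadraticTwist (-1)).HasAdditiveReductionAt v)
    (n : ℕ) : (W'.LFunction n).natAbs = (W.LFunction n).natAbs := by
  haveI : (W.quadraticTwist ((-1) : ℚ)).IsElliptic := W.isElliptic_quadraticTwist (by norm_num)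
  rw [← hW', WeierstrassCurve.LFunction_smul, W.LFunction_quadraticTwist_neg_one_apply hadd n]
  refine natAbs_mul_eq_of_even_odd (χ := fun n : ℕ ↦ (ZMod.χ₄ n : ℤ)) hW0 (fun m hm ↦ ?_) n
  show (ZMod.χ₄ (m : ZMod 4) : ℤ).natAbs = 1
  rw [ZMod.χ₄_nat_eq_if_mod_four]
  split_ifs with h0 h1
  · exact absurd (Nat.dvd_of_mod_eq_zero h0) hm
  · rfl
  · rfl

/-- **Twist by `2` (`χ₈`) at `2`:** under the analogous hypotheses `|aₙ(C • (W ⊗ 2))| = |aₙ(W)|` for all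
`n` (tree: `LFunction_quadraticTwist_two_apply`).
[cite: SilvermanAEC2009, X.5 Cor. 5.4 and Exercise 10.16 (coefficients of a quadratic twist)] -/
theorem _root_.WeierstrassCurve.natAbs_LFunction_eq_of_quadraticTwist_two
    {W W' : WeierstrassCurve ℚ} [W.IsElliptic] (C : WeierstrassCurve.VariableChange ℚ)
    (hW' : C • W.quadraticTwist 2 = W')
    (hW0 : ∀ n : ℕ, 2 ∣ n → W.LFunction n = 0)
    (hadd : ∀ v : HeightOneSpectrum (𝓞 ℚ), (primesEquiv v : ℕ) = 2 →
      (W.quadraticTwist 2).HasAdditiveReductionAt v)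
    (n : ℕ) : (W'.LFunction n).natAbs = (W.LFunction n).natAbs := by
  haveI : (W.quadraticTwist (2 : ℚ)).IsElliptic := W.isElliptic_quadraticTwist (by norm_num)
  rw [← hW', WeierstrassCurve.LFunction_smul, W.LFunction_quadraticTwist_two_apply hadd n]
  refine natAbs_mul_eq_of_even_odd (χ := fun n : ℕ ↦ (ZMod.χ₈ n : ℤ)) hW0 (fun m hm ↦ ?_) n
  show (ZMod.χ₈ (m : ZMod 8) : ℤ).natAbs = 1
  rw [ZMod.χ₈_nat_eq_if_mod_eight]
  split_ifs with h0 h1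
  · exact absurd (Nat.dvd_of_mod_eq_zero h0) hm
  · rfl
  · rfl

/-- **Twist by `−2` (`χ₈′`) at `2`:** under the analogous hypotheses `|aₙ(C • (W ⊗ (−2)))| = |aₙ(W)|` for
all `n` (tree: `LFunction_quadraticTwist_neg_two_apply`).
[cite: SilvermanAEC2009, X.5 Cor. 5.4 and Exercise 10.16 (coefficients of a quadratic twist)] -/
theorem _root_.WeierstrassCurve.natAbs_LFunction_eq_of_quadraticTwist_neg_two
    {W W' : WeierstrassCurve ℚ} [W.IsElliptic] (C : WeierstrassCurve.VariableChange ℚ)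
    (hW' : C • W.quadraticTwist (-2) = W')
    (hW0 : ∀ n : ℕ, 2 ∣ n → W.LFunction n = 0)
    (hadd : ∀ v : HeightOneSpectrum (𝓞 ℚ), (primesEquiv v : ℕ) = 2 →
      (W.quadraticTwist (-2)).HasAdditiveReductionAt v)
    (n : ℕ) : (W'.LFunction n).natAbs = (W.LFunction n).natAbs := by
  haveI : (W.quadraticTwist ((-2) : ℚ)).IsElliptic := W.isElliptic_quadraticTwist (by norm_num)
  rw [← hW', WeierstrassCurve.LFunction_smul, W.LFunction_quadraticTwist_neg_two_apply hadd n]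
  refine natAbs_mul_eq_of_even_odd (χ := fun n : ℕ ↦ (ZMod.χ₈' n : ℤ)) hW0 (fun m hm ↦ ?_) n
  show (ZMod.χ₈' (m : ZMod 8) : ℤ).natAbs = 1
  rw [ZMod.χ₈'_nat_eq_if_mod_eight]
  split_ifs with h0 h1
  · exact absurd (Nat.dvd_of_mod_eq_zero h0) hm
  · rfl
  · rfl

/-- **The `2`-adic dictionary for the twist by `−1`:**
`v₂(D′.c) = v₂(D.c) ↔ 6·v₂(D′.deg) + v₂(Δ_min W) = 6·v₂(D.deg) + v₂(Δ_min W′)` for `W′ = C • (W ⊗ (−1))`,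
`aₙ(W) = 0` for even `n`, the naive twist additive at `2`, both models globally minimal, data at a common
level (cell `bsd-f2-manin`: with `|c| = |c′| = 1` the two conjuncts of its law E-imc-8 `MinusOneTwistFlat`
become equivalent on commuting pairs).
[cite: Watkins2002, §2.1 (p. 491)] -/
theorem padicValInt_two_c_eq_iff_of_quadraticTwist_neg_one
    {W W' : WeierstrassCurve ℚ} [W.IsElliptic] [W.IsGloballyMinimal] [W'.IsElliptic]
    [W'.IsGloballyMinimal] {N : ℕ} [NeZero N] (C : WeierstrassCurve.VariableChange ℚ)
    (hW' : C • W.quadraticTwist (-1) = W')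
    (hW0 : ∀ n : ℕ, 2 ∣ n → W.LFunction n = 0)
    (hadd : ∀ v : HeightOneSpectrum (𝓞 ℚ), (primesEquiv v : ℕ) = 2 →
      (W.quadraticTwist (-1)).HasAdditiveReductionAt v)
    (D : ModularParametrizationData W N) (D' : ModularParametrizationData W' N) :
    padicValInt 2 D'.maninConstant = padicValInt 2 D.maninConstant ↔
      6 * padicValNat 2 D'.modularDegree + padicValInt 2 W.minimalDiscriminantInt =
        6 * padicValNat 2 D.modularDegree + padicValInt 2 W'.minimalDiscriminantInt :=
  haveI : Fact (Nat.Prime 2) := ⟨Nat.prime_two⟩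
  padicValInt_c_eq_iff_of_quadraticTwist_of_natAbs_eq 2 (-1) (by norm_num) C hW'
    (natAbs_LFunction_eq_of_quadraticTwist_neg_one C hW' hW0 hadd) D D'

/-- The `2`-adic dictionary for the twist by `2` (`χ₈`), same shape.
[cite: Watkins2002, §2.1 (p. 491)] -/
theorem padicValInt_two_c_eq_iff_of_quadraticTwist_two
    {W W' : WeierstrassCurve ℚ} [W.IsElliptic] [W.IsGloballyMinimal] [W'.IsElliptic]
    [W'.IsGloballyMinimal] {N : ℕ} [NeZero N] (C : WeierstrassCurve.VariableChange ℚ)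
    (hW' : C • W.quadraticTwist 2 = W')
    (hW0 : ∀ n : ℕ, 2 ∣ n → W.LFunction n = 0)
    (hadd : ∀ v : HeightOneSpectrum (𝓞 ℚ), (primesEquiv v : ℕ) = 2 →
      (W.quadraticTwist 2).HasAdditiveReductionAt v)
    (D : ModularParametrizationData W N) (D' : ModularParametrizationData W' N) :
    padicValInt 2 D'.maninConstant = padicValInt 2 D.maninConstant ↔
      6 * padicValNat 2 D'.modularDegree + padicValInt 2 W.minimalDiscriminantInt =
        6 * padicValNat 2 D.modularDegree + padicValInt 2 W'.minimalDiscriminantInt :=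
  haveI : Fact (Nat.Prime 2) := ⟨Nat.prime_two⟩
  padicValInt_c_eq_iff_of_quadraticTwist_of_natAbs_eq 2 2 (by norm_num) C hW'
    (natAbs_LFunction_eq_of_quadraticTwist_two C hW' hW0 hadd) D D'

/-- The `2`-adic dictionary for the twist by `−2` (`χ₈′`), same shape.
[cite: Watkins2002, §2.1 (p. 491)] -/
theorem padicValInt_two_c_eq_iff_of_quadraticTwist_neg_two
    {W W' : WeierstrassCurve ℚ} [W.IsElliptic] [W.IsGloballyMinimal] [W'.IsElliptic]
    [W'.IsGloballyMinimal] {N : ℕ} [NeZero N] (C : WeierstrassCurve.VariableChange ℚ)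
    (hW' : C • W.quadraticTwist (-2) = W')
    (hW0 : ∀ n : ℕ, 2 ∣ n → W.LFunction n = 0)
    (hadd : ∀ v : HeightOneSpectrum (𝓞 ℚ), (primesEquiv v : ℕ) = 2 →
      (W.quadraticTwist (-2)).HasAdditiveReductionAt v)
    (D : ModularParametrizationData W N) (D' : ModularParametrizationData W' N) :
    padicValInt 2 D'.maninConstant = padicValInt 2 D.maninConstant ↔
      6 * padicValNat 2 D'.modularDegree + padicValInt 2 W.minimalDiscriminantInt =
        6 * padicValNat 2 D.modularDegree + padicValInt 2 W'.minimalDiscriminantInt :=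
  haveI : Fact (Nat.Prime 2) := ⟨Nat.prime_two⟩
  padicValInt_c_eq_iff_of_quadraticTwist_of_natAbs_eq 2 (-2) (by norm_num) C hW'
    (natAbs_LFunction_eq_of_quadraticTwist_neg_two C hW' hW0 hadd) D D'

end ModularParametrizationData

end Literature.NumberTheory.EllipticCurves.ModularForms

end
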